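import Literature.Analysis.Pluripotential.PshLocalIntegrability
import Literature.Analysis.Pluripotential.SubspaceRestrictionCurrent
import HarnessLib

/-!
# The identity principle for plurisubharmonic functions, and restriction of currents to
subspaces through one non-polar point

Topic `Literature/Analysis/Pluripotential`. A plurisubharmonic function on `ℂᵐ` which is finite at
ONE point is finite on a dense set: it is not identically `-∞` on any non-empty open set
(`IsPlurisubharmonicOn.frequently_ne_bot_of_ne_bot`) — by the polydisc mean-value inequality in
`[0, ∞]` form (`IsPlurisubharmonicOn.lintegral_closedBall_negPart_le_pi`,
`PshLocalIntegrability.lean`): `∫_{P̄(z₀, ρ)} u⁻ < ∞` as soon as `u z₀ ≠ -∞`, while an open patch of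
`-∞`'s inside the polydisc would make the integral infinite. Consequence for currents on `ℙᴺ`:
the non-polarity hypothesis of the restriction `T|_{ℙ(ι)}` to a projective linear subspace
(`ClosedPositiveOneOneCurrent.restrictLinear`, `SubspaceRestrictionCurrent.lean`) holds as soon as
the cone potential of `T` is finite at ONE non-zero point of the subspace
(`ClosedPositiveOneOneCurrent.frequently_pot_comp_ne_bot_of_ne_bot`; chart-wise identity
principle plus log-homogeneity), whence the restriction `restrictLinearOfNeBot`.

## References

* [HormanderSCV1973] L. Hörmander, An introduction to complex analysis in several variables
  (1973), Thm. 1.6.3 and §2.6 (psh functions `≢ -∞` are locally integrable) — used through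
  `PshLocalIntegrability.lean`.
* [Siu1974] Y.-T. Siu, Invent. Math. 27 (1974), §2 (restriction of closed positive currents to
  subspaces not contained in the polar set).
-/

noncomputable section

open scoped Topology ENNReal Manifold ContDiff LinearAlgebra.Projectivization
open MeasureTheory Filter Set Metric

namespace Literature.Analysis.Pluripotential

/-! ### The identity principle -/

/-- **Identity principle for plurisubharmonic functions on `ℂᵐ`**: if `u` is psh on `ℂᵐ` and
`u z₀ ≠ -∞` at one point, then near every point `u` is frequently `≠ -∞` (no non-empty open set
of `-∞`'s). [cite: HormanderSCV1973, Thm. 1.6.3 and §2.6] -/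
theorem IsPlurisubharmonicOn.frequently_ne_bot_of_ne_bot {m : ℕ} {u : (Fin m → ℂ) → EReal}
    (hu : IsPlurisubharmonicOn u univ) {z₀ : Fin m → ℂ} (hz₀ : u z₀ ≠ ⊥) (z : Fin m → ℂ) :
    ∃ᶠ y in 𝓝 z, u y ≠ ⊥ := by
  intro hev
  simp only [not_ne_iff] at hev
  obtain ⟨δ, hδ, hball⟩ := Metric.eventually_nhds_iff_ball.1 hev
  -- a polydisc around `z₀` containing `ball z δ`
  set ρ : ℝ := dist z z₀ + δ with hρ
  have hρ0 : 0 < ρ := add_pos_of_nonneg_of_pos dist_nonneg hδ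
  have hsub : ball z δ ⊆ closedBall z₀ ρ := fun y hy ↦ by
    rw [mem_closedBall]
    have := dist_triangle y z z₀
    rw [mem_ball] at hy
    linarith
  -- an upper bound for `u` on the polydisc
  have hlt := sSup_image_closedBall_lt_top hu.upperSemicontinuousOn (fun y _ ↦ hu.lt_top (mem_univ y))
    (subset_univ (closedBall z₀ ρ))
  obtain ⟨M, hM⟩ : ∃ M : ℝ, ∀ y ∈ closedBall z₀ ρ, u y ≤ M := by
    rcases eq_or_ne (sSup (u '' closedBall z₀ ρ)) ⊥ with hb | hb
    · exact ⟨0, fun y hy ↦ (le_sSup (mem_image_of_mem u hy)).trans (hb ▸ bot_le)⟩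
    · refine ⟨(sSup (u '' closedBall z₀ ρ)).toReal, fun y hy ↦ ?_⟩
      rw [EReal.coe_toReal hlt.ne hb]
      exact le_sSup (mem_image_of_mem u hy)
  -- the polydisc inequality: the negative part is integrable
  have hfin := IsPlurisubharmonicOn.lintegral_closedBall_negPart_le_pi m u hu z₀ hρ0 hM
  have hrhs : ((m : ℝ≥0∞) * ENNReal.ofReal (max M 0) + (-u z₀).toENNReal) *
      volume (closedBall z₀ ρ) < ⊤ := by
    refine ENNReal.mul_lt_top (ENNReal.add_lt_top.2 ⟨?_, ?_⟩) measure_closedBall_lt_top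
    · exact ENNReal.mul_lt_top (ENNReal.natCast_lt_top m) ENNReal.ofReal_lt_top
    · rw [lt_top_iff_ne_top, Ne, EReal.toENNReal_eq_top_iff, EReal.neg_eq_top_iff]
      exact hz₀
  -- but on `ball z δ` the integrand is `⊤`
  have hball' : ∀ y ∈ ball z δ, (-u y).toENNReal = ⊤ := fun y hy ↦ by
    rw [hball y hy, EReal.neg_bot, EReal.toENNReal_top]
  have hlow : ∫⁻ y in ball z δ, (-u y).toENNReal = ⊤ := by
    rw [setLIntegral_congr_fun measurableSet_ball hball', setLIntegral_const, ENNReal.top_mul]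
    exact (measure_ball_pos volume z hδ).ne'
  have hmono : ∫⁻ y in ball z δ, (-u y).toENNReal ≤ ∫⁻ y in closedBall z₀ ρ, (-u y).toENNReal :=
    lintegral_mono_set hsub
  rw [hlow, top_le_iff] at hmono
  exact ((hfin.trans_lt hrhs).ne) hmono

namespace ClosedPositiveOneOneCurrent

variable {M N : ℕ}

/-- The affine chart parametrisation `w ↦ (w₀, …, 1ᵢ, …)` is `w ↦ L w + eᵢ` with `L` the
extension by zero along `i.succAbove` (linear). [folklore] -/
theorem insertNth_one_eq_extend_add_single (i : Fin (M + 1)) (w : Fin M → ℂ) :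
    (Fin.insertNth i (1 : ℂ) w : Fin (M + 1) → ℂ) =
      Function.ExtendByZero.linearMap ℂ i.succAbove w + Pi.single i 1 := by
  funext k
  rw [Pi.add_apply, Function.ExtendByZero.linearMap_apply]
  refine Fin.succAboveCases i ?_ (fun j ↦ ?_) k
  · rw [Fin.insertNth_apply_same, Pi.single_eq_same,
      Function.extend_apply' _ _ _ fun ⟨j, hj⟩ ↦ Fin.succAbove_ne i j hj, Pi.zero_apply, zero_add]
  · rw [Fin.insertNth_apply_succAbove, Fin.succAbove_right_injective.extend_apply,
      Pi.single_eq_of_ne (Fin.succAbove_ne i j), add_zero]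

/-- **The chart potentials of `V ∘ ι` are plurisubharmonic on all of `ℂᴹ`**, for `ι` injective
linear. [folklore] -/
theorem isPlurisubharmonicOn_pot_comp_insertNth (T : ClosedPositiveOneOneCurrent N)
    (ι : (Fin (M + 1) → ℂ) →ₗ[ℂ] (Fin (N + 1) → ℂ)) (hι : Function.Injective ι) (i : Fin (M + 1)) :
    IsPlurisubharmonicOn (fun w : Fin M → ℂ ↦ T.pot (ι (Fin.insertNth i (1 : ℂ) w))) univ := by
  set A : (Fin M → ℂ) →L[ℂ] (Fin (N + 1) → ℂ) :=
    LinearMap.toContinuousLinearMap (ι ∘ₗ Function.ExtendByZero.linearMap ℂ i.succAbove) with hA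
  have h := T.isPlurisubharmonicOn_pot.comp_clm_add A (ι (Pi.single i 1))
  have hfun : (fun w : Fin M → ℂ ↦ T.pot (ι (Fin.insertNth i (1 : ℂ) w))) =
      fun w ↦ T.pot (A w + ι (Pi.single i 1)) := by
    funext w
    rw [insertNth_one_eq_extend_add_single, map_add]
    rfl
  have hset : ((fun w : Fin M → ℂ ↦ A w + ι (Pi.single i 1)) ⁻¹' ({0}ᶜ : Set (Fin (N + 1) → ℂ))) =
      univ := by
    refine eq_univ_of_forall fun w ↦ ?_
    rw [mem_preimage, mem_compl_singleton_iff]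
    have : A w + ι (Pi.single i 1) = ι (Fin.insertNth i (1 : ℂ) w) := by
      rw [insertNth_one_eq_extend_add_single, map_add]; rfl
    rw [this]
    intro h0
    have h1 : (Fin.insertNth i (1 : ℂ) w : Fin (M + 1) → ℂ) = 0 := hι (by rw [h0, map_zero])
    have := congrFun h1 i
    simp at this
  rw [hfun, ← hset]
  exact h

/-- Log-homogeneity along a chart: `V(ι(a • y)) = V(ι y) + c log |a|`. [folklore] -/
theorem pot_comp_smul (T : ClosedPositiveOneOneCurrent N)
    (ι : (Fin (M + 1) → ℂ) →ₗ[ℂ] (Fin (N + 1) → ℂ)) (hι : Function.Injective ι) {a : ℂ} (ha : a ≠ 0)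
    {y : Fin (M + 1) → ℂ} (hy : y ≠ 0) :
    T.pot (ι (a • y)) = T.pot (ι y) + ((T.degree * Real.log ‖a‖ : ℝ) : EReal) := by
  rw [map_smul]
  exact T.isLogHomogeneous_pot a (ι y) ha fun h0 ↦ hy (hι (by rw [h0, map_zero]))

/-- `V(ι(a • y)) ≠ -∞ ↔ V(ι y) ≠ -∞` for `a ≠ 0`. [folklore] -/
theorem pot_comp_smul_ne_bot_iff (T : ClosedPositiveOneOneCurrent N)
    (ι : (Fin (M + 1) → ℂ) →ₗ[ℂ] (Fin (N + 1) → ℂ)) (hι : Function.Injective ι) {a : ℂ} (ha : a ≠ 0)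
    {y : Fin (M + 1) → ℂ} (hy : y ≠ 0) :
    T.pot (ι (a • y)) ≠ ⊥ ↔ T.pot (ι y) ≠ ⊥ := by
  rw [T.pot_comp_smul ι hι ha hy]
  constructor
  · intro h h0
    rw [h0, EReal.bot_add] at h
    exact h rfl
  · intro h h0
    exact h (EReal.add_eq_bot_iff.1 h0 |>.resolve_right (EReal.coe_ne_bot _))

/-- **One non-polar point suffices**: if the cone potential of `T` is finite at one non-zero
point `v₀` of the subspace `ι(ℂ^{M+1})`, then `V ∘ ι` is frequently finite near EVERY non-zero
point — the non-polarity hypothesis of `restrictLinear`. Proof: in each affine chart the chart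
potential `w ↦ V(ι(w₀, …, 1ᵢ, …))` is psh on `ℂᴹ` and finite somewhere (transported from `v₀`
through a point of the chart overlap by the identity principle and log-homogeneity), hence
frequently finite everywhere by the identity principle; push forward along the chart.
[cite: Siu1974, §2; HormanderSCV1973, Thm. 1.6.3] -/
theorem frequently_pot_comp_ne_bot_of_ne_bot (T : ClosedPositiveOneOneCurrent N)
    (ι : (Fin (M + 1) → ℂ) →ₗ[ℂ] (Fin (N + 1) → ℂ)) (hι : Function.Injective ι)
    {v₀ : Fin (M + 1) → ℂ} (hv₀ : v₀ ≠ 0) (h₀ : T.pot (ι v₀) ≠ ⊥) :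
    ∀ v : Fin (M + 1) → ℂ, v ≠ 0 → ∃ᶠ y in 𝓝 v, T.pot (ι y) ≠ ⊥ := by
  -- chart potentials and their basic property
  set h : Fin (M + 1) → (Fin M → ℂ) → EReal := fun i w ↦ T.pot (ι (Fin.insertNth i (1 : ℂ) w))
    with hh
  have hpsh : ∀ i, IsPlurisubharmonicOn (h i) univ := fun i ↦
    T.isPlurisubharmonicOn_pot_comp_insertNth ι hι i
  have hins : ∀ (i : Fin (M + 1)) (w : Fin M → ℂ), (Fin.insertNth i (1 : ℂ) w : Fin (M + 1) → ℂ) ≠ 0 :=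
    fun i w h0 ↦ by have := congrFun h0 i; simp at this
  -- a point `y ≠ 0` with `yᵢ ≠ 0` and `V(ι y) ≠ ⊥` makes `h i` finite at the chart coordinates of `y`
  have hchart : ∀ (i : Fin (M + 1)) (y : Fin (M + 1) → ℂ), y i ≠ 0 → T.pot (ι y) ≠ ⊥ →
      h i (fun j ↦ y (i.succAbove j) / y i) ≠ ⊥ := by
    intro i y hyi hy
    have hy0 : y ≠ 0 := fun h0 ↦ hyi (by rw [h0]; rfl)
    have heq := eq_smul_insertNth_one i hyi
    have : T.pot (ι y) = T.pot (ι (y i • Fin.insertNth i (1 : ℂ) (fun j ↦ y (i.succAbove j) / y i))) := by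
      rw [← heq]
    rw [this, T.pot_comp_smul_ne_bot_iff ι hι hyi (hins i _)] at hy
    exact hy
  -- every chart potential is finite somewhere
  have hsome : ∀ i, ∃ w, h i w ≠ ⊥ := by
    intro i
    by_cases hv₀i : v₀ i ≠ 0
    · exact ⟨_, hchart i v₀ hv₀i h₀⟩
    · push Not at hv₀i
      -- a chart `j` containing `v₀`
      obtain ⟨j, hj⟩ : ∃ j, v₀ j ≠ 0 := by
        by_contra hall
        push Not at hall
        exact hv₀ (funext hall)
      have hji : j ≠ i := fun hji ↦ hj (hji ▸ hv₀i)
      have hjfin : h j (fun k ↦ v₀ (j.succAbove k) / v₀ j) ≠ ⊥ := hchart j v₀ hj h₀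
      -- chart coordinates (in chart `j`) of the point `eᵢ + eⱼ`
      obtain ⟨k₀, hk₀⟩ : ∃ k, j.succAbove k = i := Fin.exists_succAbove_eq hji.symm
      set w₁ : Fin M → ℂ := fun k ↦ if j.succAbove k = i then 1 else 0 with hw₁
      -- near `w₁` the `i`-th coordinate of the chart point stays non-zero
      have hopen : ∀ᶠ w in 𝓝 w₁, (Fin.insertNth j (1 : ℂ) w : Fin (M + 1) → ℂ) i ≠ 0 := by
        have hcont : Continuous fun w : Fin M → ℂ ↦ (Fin.insertNth j (1 : ℂ) w : Fin (M + 1) → ℂ) i := by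
          have : (fun w : Fin M → ℂ ↦ (Fin.insertNth j (1 : ℂ) w : Fin (M + 1) → ℂ) i) =
              fun w ↦ w k₀ := by
            funext w; rw [← hk₀, Fin.insertNth_apply_succAbove]
          rw [this]; exact continuous_apply k₀
        refine hcont.continuousAt.eventually_ne ?_
        rw [← hk₀, Fin.insertNth_apply_succAbove, hw₁]
        simp [hk₀]
      obtain ⟨w₂, hw₂, hw₂i⟩ :=
        (((hpsh j).frequently_ne_bot_of_ne_bot hjfin w₁).and_eventually hopen).exists
      -- transport to chart `i`
      exact ⟨_, hchart i (Fin.insertNth j (1 : ℂ) w₂) hw₂i hw₂⟩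
  -- conclusion at a point `v ≠ 0`, through a chart `i` containing it
  intro v hv
  obtain ⟨i, hvi⟩ : ∃ i, v i ≠ 0 := by
    by_contra hall
    push Not at hall
    exact hv (funext hall)
  obtain ⟨w, hw⟩ := hsome i
  set wv : Fin M → ℂ := fun j ↦ v (i.succAbove j) / v i with hwv
  have hfreq : ∃ᶠ w' in 𝓝 wv, h i w' ≠ ⊥ := (hpsh i).frequently_ne_bot_of_ne_bot hw wv
  -- push forward along `ψ(w') = vᵢ • (w'₀, …, 1ᵢ, …)`, `ψ(wv) = v`
  set ψ : (Fin M → ℂ) → (Fin (M + 1) → ℂ) := fun w' ↦ v i • Fin.insertNth i (1 : ℂ) w' with hψ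
  have hψc : Continuous ψ :=
    (Continuous.finInsertNth i continuous_const continuous_id).const_smul (v i)
  have hψv : ψ wv = v := by rw [hψ, hwv]; exact (eq_smul_insertNth_one i hvi).symm
  have htend : Tendsto ψ (𝓝 wv) (𝓝 v) := hψv ▸ hψc.continuousAt
  refine htend.frequently (hfreq.mono fun w' hw' ↦ ?_)
  show T.pot (ι (v i • Fin.insertNth i (1 : ℂ) w')) ≠ ⊥
  exact (T.pot_comp_smul_ne_bot_iff ι hι hvi (hins i w')).2 hw'

/-- **Restriction through one non-polar point**: the restriction of `T` to the projective linear
subspace `ℙ(ι)`, given one non-zero `v₀` in the subspace with `V(ι v₀) ≠ -∞`.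
[cite: Siu1974, §2] -/
def restrictLinearOfNeBot (T : ClosedPositiveOneOneCurrent N)
    (ι : (Fin (M + 1) → ℂ) →ₗ[ℂ] (Fin (N + 1) → ℂ)) (hι : Function.Injective ι)
    {v₀ : Fin (M + 1) → ℂ} (hv₀ : v₀ ≠ 0) (h₀ : T.pot (ι v₀) ≠ ⊥) : ClosedPositiveOneOneCurrent M :=
  T.restrictLinear ι hι (T.frequently_pot_comp_ne_bot_of_ne_bot ι hι hv₀ h₀)

/-- The cone potential of `restrictLinearOfNeBot` is `V ∘ ι`. [folklore] -/
@[simp] theorem restrictLinearOfNeBot_pot (T : ClosedPositiveOneOneCurrent N)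
    (ι : (Fin (M + 1) → ℂ) →ₗ[ℂ] (Fin (N + 1) → ℂ)) (hι : Function.Injective ι)
    {v₀ : Fin (M + 1) → ℂ} (hv₀ : v₀ ≠ 0) (h₀ : T.pot (ι v₀) ≠ ⊥) (v : Fin (M + 1) → ℂ) :
    (T.restrictLinearOfNeBot ι hι hv₀ h₀).pot v = T.pot (ι v) := rfl

/-- `E_c(T) ∩ ℙ(ι)(ℙᴹ) ⊆ ℙ(ι)(E_c(T|))` for the restriction through one non-polar point.
[cite: Siu1974, §2] -/
theorem lelongUpperLevelSet_inter_range_subset_of_ne_bot (T : ClosedPositiveOneOneCurrent N)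
    (ι : (Fin (M + 1) → ℂ) →ₗ[ℂ] (Fin (N + 1) → ℂ)) (hι : Function.Injective ι)
    {v₀ : Fin (M + 1) → ℂ} (hv₀ : v₀ ≠ 0) (h₀ : T.pot (ι v₀) ≠ ⊥) (c : ℝ) :
    T.lelongUpperLevelSet c ∩ range (Projectivization.map ι hι) ⊆
      Projectivization.map ι hι '' (T.restrictLinearOfNeBot ι hι hv₀ h₀).lelongUpperLevelSet c :=
  T.lelongUpperLevelSet_inter_range_subset ι hι _ c

end ClosedPositiveOneOneCurrent

end Literature.Analysis.Pluripotential

end
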